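import Literature.AnabelianGeometry.EtaleTheta.SettingModelTateInversionRecentred
import HarnessLib

/-!
# The stage-2 («Tate shear») model of [EtTh] §1 at `(i, j) = (2, 2)`: the `log(Ü)`-TWISTED class satisfies the inversion
# clauses of Prop. 1.5 (iii) for the RE-CENTRED inversion `ι′ = Inn(σ₀⁻¹) ∘ ι` — and the JOINT instance
# {Prop. 1.5 (iii) `Z`-law ∧ inversion clauses ∧ deck-sign clause} at one datum (proof-only; non-vacuity)

S. Mochizuki, *The étale theta function and its Frobenioid-theoretic manifestations*, Publ. RIMS **45** (2009) [EtTh], §1,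
Prop. 1.5 (iii), PRIMS PDF p. 23 (printed 249): «any inversion automorphism ι of Π^tp_X … fixes η̈^Θ + log(O^×_K̈), but maps
log(Ü) + log(O^×_K̈) to −log(Ü) + log(O^×_K̈)»; Prop. 1.4 (ii) p. 22 («Θ̈(−Ü) = −Θ̈(Ü)») [cite: MochizukiEtTh2009, Prop 1.5 (iii) p.23].
abc-iut cell, layer L2, seat abc-iut-L2-t12 (gen 10); row (T3) «JOINT-INV@(2,2)», file B (sequel to this seat's
`SettingModelTateInversionRecentred` = file A, `SettingModelTateTwistedProp15iii` p501580, `SettingModelTateDeckTwist` p500679).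
PROOF-ONLY: no definition, no instance, no `Prop` fact; everything BY NAME (file A's `IsInversionAut.transport_trans_conj`,
`transport_inflTheta_logUdd_kummerCoreχq_two_two`, `conj_deckGen_inv_logUdd`, `conj_deckGen_inv_zClassYddχq_two_two`; abc-iut-L2-d1's
`transport_etaDdχq` / `transport_inflTheta_kumYdd_ofSection`; abc-iut-L2-t12's `conj_kumYdd_toKddHat_ofSection` (D2) and
`inflTheta_injective`; p501580's `prop15iii_etaDdTwistχq_two_two` / `hdeck_etaDdTwistχq_two_two`).

THE RECORD: at `modelχq p 2 2` the typed Prop. 1.5 (iii) `Z`-law AND the deck-sign clause hold for the twisted class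
`η̈♯″ = etaDdχq · infl(log Ü)` (p501580), while the inversion OF RECORD `ι = inversionχq p 2 2` has defect `κ̈(q̈)⁻¹` on `log(Ü)`
(file A) — clause (b) fails for it.  THIS FILE (numbers, not a side): for the RE-CENTRED inversion `ι′ := Inn(σ₀⁻¹) ∘ ι`
(`σ₀ = (a, 1)` the deck generator; an `IsInversionAut`, file A) and EVERY theta companion of it,
* **`transport_recentred_inflTheta_logUdd_two_two`** — `ι′_* infl(log Ü) = infl(log Ü)⁻¹` EXACTLY;
* **`transport_recentred_etaDdTwistχq_two_two`** — `ι′_* η̈♯″ = η̈♯″` EXACTLY;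
* **`invClauses_etaDdTwistχq_recentred_two_two`** — `InvClauses E″ (IsInversionAut ι′) cι′` for the étale-theta datum `E″` of
  `η̈♯″` over the section Kummer datum of ANY Galois section `s` (clause (a) pointwise, clause (b) with `u := 1`);
* **`exists_prop15iii_invClauses_hdeck_modelχq_two_two`** / **`ThetaSetting.exists_isEtThOrigin_prop15iii_invClauses_hdeck_stageTwo`**
  — the JOINT ∃-form {`Prop15iii E hC` ∧ `InvClauses E hι cι` ∧ (P14ii-cl)} at ONE datum of a stage-2 setting of record — the
  first such in the tree (closing the «no joint instance of the full binder set» caveat of p491944's header for the family).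
NOT CLAIMED: `Prop15iiiInv E″` (the clause for EVERY inversion automorphism fixing the cusp below a label-0 cuspidal point —
for the inversion of record `ι` the transport of `log(Ü)` carries the factor `κ̈(q̈)⁻¹`, file A, so clause (b) for `ι` would need
`κ̈(q̈)` to be a unit class; whether `FixesCuspBelow` singles out `ι′` is not examined), anything at `(i, j) ≠ (2, 2)`, and the
commutator-axis cusp datum (G-L2t12g9-1 proper).
HONEST FRAMING: SEMI-SYNTHETIC model — consistency / non-vacuity evidence for the typed interface ONLY; [EtTh] is refereed and
nothing of it is disputed or asserted; typed ≠ proved; inhabited-at-a-model ≠ proved; no side taken on [IUTchIII] Cor. 3.12.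
-/

noncomputable section

namespace Literature.AnabelianGeometry.EtaleTheta.SettingModel

open Literature.AnabelianGeometry.SemiGraphs Literature.AnabelianGeometry.AbsoluteAnabelian

variable (p : ℕ) [Fact p.Prime] (i j : ℤ)

section Recentred

variable (hj : Even j)

/-- **`Inn(τ) ∘ ι` fixes `log(O^×_K̈)`** of the section datum of any Galois section `s` (all `i`, even `j`, `τ ∈ Δ^tp_X`, every
companion): `ι` fixes it (abc-iut-L2-d1's `transport_inflTheta_kumYdd_ofSection`) and `Δ^tp_X`-conjugation fixes the unit
classes (`conj_kumYdd_toKddHat_ofSection`, trivial Galois coordinate). [cite: MochizukiEtTh2009, Prop 1.5 (iii) p.23] -/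
theorem transport_trans_conj_eq_self_of_mem_kumUnitsYdd (hC : (ThetaSetting.modelχq p i j hj).Compat) {τ : PiTpχq p i j}
    (hτ : (ThetaSetting.modelχq p i j hj).aug τ = 1)
    (c' : ThetaSetting.ThetaCompanion (Dα := ThetaSetting.modelχq p i j hj) (Dβ := ThetaSetting.modelχq p i j hj)
      ((inversionχq p i j).trans (conjContinuousMulEquiv τ)))
    (s : GQp p →* PiTpχq p i j) (hs : Continuous s) (hsec : ∀ σ : GQp p, (ThetaSetting.modelχq p i j hj).aug (s σ) = σ)
    (hsY : (ThetaSetting.modelχq p i j hj).GK.map s ≤ (ThetaSetting.modelχq p i j hj).GtpY)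
    (hsYdd : (ThetaSetting.modelχq p i j hj).GKdd.map s ≤ (ThetaSetting.modelχq p i j hj).GtpYdd)
    {k : (ThetaSetting.modelχq p i j hj).H1 (ThetaSetting.modelχq p i j hj).GtpYdd}
    (hk : k ∈ ((kummerCoreχq p i j hj).toKummerDataOfSection s hs hsec hsY hsYdd).kumUnitsYdd) :
    ThetaSetting.transport c' (isInversionAut_inversionχq_trans_conj p i j hj hτ).thm16i k = k := by
  haveI := hC.GtpYdd_normal
  haveI := hC.GtpYddTheta_normal
  obtain ⟨c₀⟩ := nonempty_thetaCompanion_inversionχq p i j hj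
  obtain ⟨c, ⟨u, hu, rfl⟩, rfl⟩ := hk
  rw [(isInversionAut_inversionχq p i j hj).transport_trans_conj c₀ hτ c' hC, MonoidHom.comp_apply,
    transport_inflTheta_kumYdd_ofSection p i j hj c₀ s hs hsec hsY hsYdd, ← ThetaSetting.inflTheta_conj_toTheta hC,
    (kummerCoreχq p i j hj).conj_kumYdd_toKddHat_ofSection s hs hsec hsY hsYdd hC τ u u (by rw [hτ, one_smul])]

/-- **`ι′_* infl(log Ü) = infl(log Ü)⁻¹` EXACTLY at `modelχq p 2 2`** for the re-centred inversion `ι′ = Inn(σ₀⁻¹) ∘ ι` and EVERY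
theta companion of it: the defect `κ̈(q̈)⁻¹` of `ι` (`transport_inflTheta_logUdd_kummerCoreχq_two_two`) is cancelled by
`σ₀⁻¹·log(Ü) = log(Ü)·κ̈(q̈)⁻¹`. [cite: MochizukiEtTh2009, Prop 1.5 (iii) p.23] -/
theorem transport_recentred_inflTheta_logUdd_two_two (hC : (ThetaSetting.modelχq p 2 2 even_two).Compat)
    (c' : ThetaSetting.ThetaCompanion (Dα := ThetaSetting.modelχq p 2 2 even_two) (Dβ := ThetaSetting.modelχq p 2 2 even_two)
      ((inversionχq p 2 2).trans
        (conjContinuousMulEquiv (SemidirectProduct.inl (gfpOf (FreeGroup.of 0)) : PiTpχq p 2 2)⁻¹))) :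
    ThetaSetting.transport c' (isInversionAut_inversionχq_recentred p 2 2 even_two).thm16i
        ((ThetaSetting.modelχq p 2 2 even_two).inflTheta (ThetaSetting.modelχq p 2 2 even_two).GtpYdd
          (kummerCoreχq p 2 2 even_two).logUdd) =
      ((ThetaSetting.modelχq p 2 2 even_two).inflTheta (ThetaSetting.modelχq p 2 2 even_two).GtpYdd
          (kummerCoreχq p 2 2 even_two).logUdd)⁻¹ := by
  haveI := hC.GtpYdd_normal
  haveI := hC.GtpYddTheta_normal
  obtain ⟨c₀⟩ := nonempty_thetaCompanion_inversionχq p 2 2 even_two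
  rw [(isInversionAut_inversionχq p 2 2 even_two).transport_trans_conj c₀ (aug_inl_inv p 2 2 even_two _) c' hC,
    transport_inflTheta_logUdd_kummerCoreχq_two_two p c₀, ← mul_inv_rev, map_inv, ← map_mul,
    ← ThetaSetting.inflTheta_conj_toTheta hC, map_mul,
    conj_kumYdd_qddUnit_of_aug_eq_one p 2 2 even_two hC (aug_inl_inv p 2 2 even_two _), conj_deckGen_inv_logUdd p 2 hC,
    mul_inv_cancel_comm_assoc]

/-- **`ι′_* η̈♯″ = η̈♯″` EXACTLY at `modelχq p 2 2`** for the `log(Ü)`-twisted class `η̈♯″ = etaDdχq · infl(log Ü)` (lift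
`x″ = x′ · log(Ü)`), the re-centred inversion and EVERY theta companion: `ι` fixes `η̈♯` (abc-iut-L2-d1's `transport_etaDdχq`) and
`σ₀⁻¹·x′ = x′·log(Ü)²`, so `ι′_* η̈♯″ = infl(x′·log(Ü)²) · infl(log Ü)⁻¹ = η̈♯″`. [cite: MochizukiEtTh2009, Prop 1.5 (iii) p.23] -/
theorem transport_recentred_etaDdTwistχq_two_two (hC : (ThetaSetting.modelχq p 2 2 even_two).Compat)
    (c' : ThetaSetting.ThetaCompanion (Dα := ThetaSetting.modelχq p 2 2 even_two) (Dβ := ThetaSetting.modelχq p 2 2 even_two)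
      ((inversionχq p 2 2).trans
        (conjContinuousMulEquiv (SemidirectProduct.inl (gfpOf (FreeGroup.of 0)) : PiTpχq p 2 2)⁻¹))) :
    ThetaSetting.transport c' (isInversionAut_inversionχq_recentred p 2 2 even_two).thm16i
        (etaDdχq p 2 2 even_two *
          (ThetaSetting.modelχq p 2 2 even_two).inflTheta (ThetaSetting.modelχq p 2 2 even_two).GtpYdd
            (kummerCoreχq p 2 2 even_two).logUdd) =
      etaDdχq p 2 2 even_two *
        (ThetaSetting.modelχq p 2 2 even_two).inflTheta (ThetaSetting.modelχq p 2 2 even_two).GtpYdd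
          (kummerCoreχq p 2 2 even_two).logUdd := by
  haveI := hC.GtpYdd_normal
  haveI := hC.GtpYddTheta_normal
  obtain ⟨c₀⟩ := nonempty_thetaCompanion_inversionχq p 2 2 even_two
  rw [map_mul, transport_recentred_inflTheta_logUdd_two_two p hC c',
    (isInversionAut_inversionχq p 2 2 even_two).transport_trans_conj c₀ (aug_inl_inv p 2 2 even_two _) c' hC,
    transport_etaDdχq p 2 2 even_two c₀, etaDdχq_def, ← ThetaSetting.inflTheta_conj_toTheta hC,
    conj_deckGen_inv_zClassYddχq_two_two p hC, map_mul, map_zpow, zpow_two, mul_assoc, mul_inv_cancel_right]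

/-- **Clause (b), every intertwiner**: an automorphism `T` of `H¹((Π^tp_Ÿ)^Θ, Δ_Θ)` intertwining the transport along `ι′`
through inflation sends `log(Ü)` to `−log(Ü)` EXACTLY (this seat's `inflTheta_injective`). [cite: MochizukiEtTh2009, Prop 1.5 (iii) p.23] -/
theorem apply_logUdd_eq_inv_recentred_two_two (hC : (ThetaSetting.modelχq p 2 2 even_two).Compat)
    (c' : ThetaSetting.ThetaCompanion (Dα := ThetaSetting.modelχq p 2 2 even_two) (Dβ := ThetaSetting.modelχq p 2 2 even_two)
      ((inversionχq p 2 2).trans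
        (conjContinuousMulEquiv (SemidirectProduct.inl (gfpOf (FreeGroup.of 0)) : PiTpχq p 2 2)⁻¹)))
    (T : (ThetaSetting.modelχq p 2 2 even_two).H1Theta
        ((ThetaSetting.modelχq p 2 2 even_two).GtpYdd.map (ThetaSetting.modelχq p 2 2 even_two).toTheta) ≃*
      (ThetaSetting.modelχq p 2 2 even_two).H1Theta
        ((ThetaSetting.modelχq p 2 2 even_two).GtpYdd.map (ThetaSetting.modelχq p 2 2 even_two).toTheta))
    (hT : ∀ z, (ThetaSetting.modelχq p 2 2 even_two).inflTheta (ThetaSetting.modelχq p 2 2 even_two).GtpYdd (T z) =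
      ThetaSetting.transport c' (isInversionAut_inversionχq_recentred p 2 2 even_two).thm16i
        ((ThetaSetting.modelχq p 2 2 even_two).inflTheta (ThetaSetting.modelχq p 2 2 even_two).GtpYdd z)) :
    T (kummerCoreχq p 2 2 even_two).logUdd = ((kummerCoreχq p 2 2 even_two).logUdd)⁻¹ := by
  apply (ThetaSetting.modelχq p 2 2 even_two).inflTheta_injective (ThetaSetting.modelχq p 2 2 even_two).GtpYdd
  rw [hT, map_inv, transport_recentred_inflTheta_logUdd_two_two p hC c']

variable (s : GQp p →* PiTpχq p 2 2) (hs : Continuous s)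
  (hsec : ∀ σ : GQp p, (ThetaSetting.modelχq p 2 2 even_two).aug (s σ) = σ)
  (hsY : (ThetaSetting.modelχq p 2 2 even_two).GK.map s ≤ (ThetaSetting.modelχq p 2 2 even_two).GtpY)
  (hsYdd : (ThetaSetting.modelχq p 2 2 even_two).GKdd.map s ≤ (ThetaSetting.modelχq p 2 2 even_two).GtpYdd)

/-- **[EtTh] Prop. 1.5 (iii), inversion clauses, WITNESSED at `modelχq p 2 2` for the `log(Ü)`-TWISTED datum** `η̈♯″ =
etaDdχq · infl(log Ü)` over the section Kummer datum of ANY Galois section `s`, the RE-CENTRED inversion `ι′ = Inn(σ₀⁻¹) ∘ ι` and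
EVERY theta companion of it: `ι′` fixes `η̈♯″ + log(O^×_K̈)` pointwise and sends `log(Ü)` to `−log(Ü)` (`u := 1`).  (For the
inversion of record `ι` itself clause (b) fails at `(2, 2)`: its defect is `κ̈(q̈)⁻¹`, `transport_inflTheta_logUdd_kummerCoreχq_two_two`;
print's inversion is «an» automorphism over `[−1]`, fixed only up to `Δ^tp_X`-inner re-centring.) [cite: MochizukiEtTh2009, Prop 1.5 (iii) p.23] -/
theorem invClauses_etaDdTwistχq_recentred_two_two (hC : (ThetaSetting.modelχq p 2 2 even_two).Compat)
    (c' : ThetaSetting.ThetaCompanion (Dα := ThetaSetting.modelχq p 2 2 even_two) (Dβ := ThetaSetting.modelχq p 2 2 even_two)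
      ((inversionχq p 2 2).trans
        (conjContinuousMulEquiv (SemidirectProduct.inl (gfpOf (FreeGroup.of 0)) : PiTpχq p 2 2)⁻¹))) :
    ThetaSetting.InvClauses
      (((kummerCoreχq p 2 2 even_two).toKummerDataOfSection s hs hsec hsY hsYdd).etaleThetaDataOfClass
        (etaDdχq p 2 2 even_two *
          (ThetaSetting.modelχq p 2 2 even_two).inflTheta (ThetaSetting.modelχq p 2 2 even_two).GtpYdd
            (kummerCoreχq p 2 2 even_two).logUdd))
      (isInversionAut_inversionχq_recentred p 2 2 even_two) c' where
  image_thetaClasses := by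
    have hfix : ∀ x ∈ (((kummerCoreχq p 2 2 even_two).toKummerDataOfSection s hs hsec hsY hsYdd).etaleThetaDataOfClass
        (etaDdχq p 2 2 even_two *
          (ThetaSetting.modelχq p 2 2 even_two).inflTheta (ThetaSetting.modelχq p 2 2 even_two).GtpYdd
            (kummerCoreχq p 2 2 even_two).logUdd)).thetaClasses,
        ThetaSetting.transport c' (isInversionAut_inversionχq_recentred p 2 2 even_two).thm16i x = x := by
      rintro x ⟨k, hk, rfl⟩
      rw [map_mul, transport_trans_conj_eq_self_of_mem_kumUnitsYdd p 2 2 even_two hC (aug_inl_inv p 2 2 even_two _) c'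
        s hs hsec hsY hsYdd hk]
      exact congrArg (k * ·) (transport_recentred_etaDdTwistχq_two_two p hC c')
    ext x
    constructor
    · rintro ⟨y, hy, rfl⟩
      rw [hfix y hy]
      exact hy
    · intro hx
      exact ⟨x, hx, hfix x hx⟩
  logUdd_inv T hT := ⟨1, Subgroup.one_mem _, by
    rw [map_one, map_one, mul_one]
    exact apply_logUdd_eq_inv_recentred_two_two p hC c' T hT⟩

end Recentred

/-! ### The JOINT instance: Prop. 1.5 (iii) `Z`-law ∧ inversion clauses ∧ deck-sign clause, one datum -/

/-- **JOINT INSTANCE (census form)**: at `modelχq p 2 2` (every `p`, every `Compat` witness) the `log(Ü)`-twisted étale-theta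
datum over the `inr`-section Kummer datum satisfies the typed Prop. 1.5 (iii) `Z`-law (p501580), the inversion clauses
`InvClauses` for the re-centred inversion automorphism `ι′ = Inn(σ₀⁻¹) ∘ ι` (an `IsInversionAut`, with a theta companion), AND
the class-level deck-sign clause (P14ii-cl) — the full Prop. 1.4 (ii)/1.5 (iii) binder set at ONE datum.
[cite: MochizukiEtTh2009, Prop 1.5 (iii) p.23] -/
theorem exists_prop15iii_invClauses_hdeck_modelχq_two_two (hC : (ThetaSetting.modelχq p 2 2 even_two).Compat) :
    haveI := hC.GtpYdd_normal
    ∃ (E : (ThetaSetting.modelχq p 2 2 even_two).EtaleThetaData)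
      (ι : (ThetaSetting.modelχq p 2 2 even_two).PiTemp ≃ₜ* (ThetaSetting.modelχq p 2 2 even_two).PiTemp)
      (hι : (ThetaSetting.modelχq p 2 2 even_two).IsInversionAut ι) (cι : ThetaSetting.ThetaCompanion ι),
      E.etaDd = etaDdχq p 2 2 even_two *
        (ThetaSetting.modelχq p 2 2 even_two).inflTheta (ThetaSetting.modelχq p 2 2 even_two).GtpYdd
          (kummerCoreχq p 2 2 even_two).logUdd ∧
      ThetaSetting.Prop15iii E hC ∧ ThetaSetting.InvClauses E hι cι ∧
      ∀ ε : PiTpχq p 2 2, ε ∈ (ThetaSetting.modelχq p 2 2 even_two).GtpY → ε ∉ (ThetaSetting.modelχq p 2 2 even_two).GtpYdd →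
        ContH1.conj (ThetaSetting.modelχq p 2 2 even_two).toTheta (ThetaSetting.modelχq p 2 2 even_two).DeltaTheta ε E.etaDd =
          (ThetaSetting.modelχq p 2 2 even_two).inflTheta (ThetaSetting.modelχq p 2 2 even_two).GtpYdd
            (E.kumYdd (E.toKddHat (-1))) * E.etaDd :=
  ⟨_, _, isInversionAut_inversionχq_recentred p 2 2 even_two,
    (nonempty_thetaCompanion_inversionχq_recentred p 2 2 even_two).some, rfl,
    prop15iii_etaDdTwistχq_two_two p SemidirectProduct.inr (continuous_inrχq p 2 2) (fun _ => rfl)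
      (map_inr_GK_le_GtpY_modelχq' p 2 2 even_two) (map_inr_GKdd_le_GtpYdd_modelχq' p 2 2 even_two) hC,
    invClauses_etaDdTwistχq_recentred_two_two p SemidirectProduct.inr (continuous_inrχq p 2 2) (fun _ => rfl)
      (map_inr_GK_le_GtpY_modelχq' p 2 2 even_two) (map_inr_GKdd_le_GtpYdd_modelχq' p 2 2 even_two) hC _,
    hdeck_etaDdTwistχq_two_two p SemidirectProduct.inr (continuous_inrχq p 2 2) (fun _ => rfl)
      (map_inr_GK_le_GtpY_modelχq' p 2 2 even_two) (map_inr_GKdd_le_GtpYdd_modelχq' p 2 2 even_two) hC⟩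

/-- **Root-level census form**: within the stage-2 family there is a theta SETTING of record (`modelχq p 2 2`, an `IsEtThOrigin`
setting with `Compat`) carrying an étale-theta datum, an inversion automorphism (Prop. 1.5 (iii)) and a theta companion for which
the typed Prop. 1.5 (iii) `Z`-law, the inversion clauses AND the deck-sign clause (P14ii-cl) hold JOINTLY.
[cite: MochizukiEtTh2009, Prop 1.5 (iii) p.23] -/
theorem _root_.Literature.AnabelianGeometry.EtaleTheta.ThetaSetting.exists_isEtThOrigin_prop15iii_invClauses_hdeck_stageTwo :
    ∃ (D : ThetaSetting p) (hC : D.Compat) (E : D.EtaleThetaData) (ι : D.PiTemp ≃ₜ* D.PiTemp) (hι : D.IsInversionAut ι)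
      (cι : ThetaSetting.ThetaCompanion ι), D = ThetaSetting.modelχq p 2 2 even_two ∧ D.IsEtThOrigin ∧
      ThetaSetting.Prop15iii E hC ∧ ThetaSetting.InvClauses E hι cι ∧
      haveI := hC.GtpYdd_normal
      ∀ ε : D.PiTemp, ε ∈ D.GtpY → ε ∉ D.GtpYdd →
        ContH1.conj D.toTheta D.DeltaTheta ε E.etaDd = D.inflTheta D.GtpYdd (E.kumYdd (E.toKddHat (-1))) * E.etaDd := by
  obtain ⟨E, ι, hι, cι, -, h15, hinv, hdeck⟩ :=
    exists_prop15iii_invClauses_hdeck_modelχq_two_two p (ThetaSetting.modelχq_sec2Hyps p 2 2 even_two).compat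
  exact ⟨_, _, E, ι, hι, cι, rfl, ThetaSetting.modelχq_isEtThOrigin p 2 2 even_two, h15, hinv, hdeck⟩


end Literature.AnabelianGeometry.EtaleTheta.SettingModel

end
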